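import Summits.AnomalousDissipation.AnomalousDissipation.Theorems.SawtoothPulseCascadeK1LocalisedCascadeKHLorentzEnvelope

/-!
# K2 lane (route-2 `SawtoothPulseCascade`, crux dir `K1LocalisedCascade`): a STABLE sheet block driven by one Lorentzian pulse responds boundedly, uniformly in the slot length

Helper file of the K2 lane (ACL item stmt-AnomalousDissipation-19491; S2-cert forced part / P1″, A26-4 (a)). The stable Kelvin–Helmholtz block has the explicit
propagator `P(t) = cos(ωt)·1 + (sin(ωt)/ω)·X` (`sheet_solution_eq`, `PropagatorODE`), and by `…KHForcingClosedForm` each forcing component is a finite sum of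
`e^{iφs}·C/(μ + i(ν₀ + νs))` with `φ ∈ {0, ±πa/2}`, `μ = ±2πa`. The Duhamel integral of ONE such term against the two scalar propagator entries is bounded,
uniformly in `θ ≥ 0`, by the pulse height scale `‖C‖/|μ|` times `(2+π)` over the two detunings `|φ ∓ ω|`:
* `norm_integral_cos_mul_lorentz_le`: `‖∫₀^θ cos(ω(θ−s)) e^{iφs} C/(μ+i(ν₀+νs)) ds‖ ≤ (‖C‖(2+π)/|μ|)·(1/|φ−ω| + 1/|φ+ω|)/2`;
* `norm_integral_sin_mul_lorentz_le`: the same for `sin(ω(θ−s))/ω` with an extra factor `1/|ω|`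
(`cos`, `sin` split into `e^{±iω(θ−s)}`, then `…KHLorentzEnvelope.norm_integral_exp_mul_lorentz_le` = ad-lit L2's integration by parts with the Lorentzian
envelope calculus). With `…KHStableDetuning` (`|πa/2 − ω| ≥ 399/401` for `a ≥ 1`) these are the per-term bounds of the stable-block creation law.
No definitions; no statement about the crux. [folklore] [problem: turb]
-/

-- `Summit.<Summit>.<Problem>`: single-conjunct summit, the duplicate namespace segment is deliberate.
set_option linter.dupNamespace false

noncomputable section

namespace Summit.AnomalousDissipation.AnomalousDissipation.Theorems.SawtoothPulseCascade.K2PhaseBudget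

open Set MeasureTheory intervalIntegral

/-- The Lorentzian forcing term `s ↦ e^{ils}·C/(μ + i(ν₀+νs))` is continuous (`μ ≠ 0`). [folklore] -/
theorem continuous_exp_mul_lorentz (C : ℂ) {μ : ℝ} (hμ : μ ≠ 0) (l ν₀ ν : ℝ) :
    Continuous fun s : ℝ => Complex.exp ((l * s : ℝ) * Complex.I) * (C / ((μ : ℂ) + ((ν₀ + ν * s : ℝ) : ℂ) * Complex.I)) := by
  refine Continuous.mul (by fun_prop) (continuous_const.div (by fun_prop) fun s => lorentz_denom_ne_zero hμ _)

/-- Splitting `cos(ω(θ−s)) e^{iφs} = ½ e^{iωθ} e^{i(φ−ω)s} + ½ e^{−iωθ} e^{i(φ+ω)s}`. [folklore] -/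
theorem cos_mul_exp_split (ω φ θ s : ℝ) :
    (Real.cos (ω * (θ - s)) : ℂ) * Complex.exp ((φ * s : ℝ) * Complex.I) =
      ((1 / 2 : ℝ) : ℂ) * Complex.exp ((ω * θ : ℝ) * Complex.I) * Complex.exp (((φ - ω) * s : ℝ) * Complex.I) +
      ((1 / 2 : ℝ) : ℂ) * Complex.exp ((-(ω * θ) : ℝ) * Complex.I) * Complex.exp (((φ + ω) * s : ℝ) * Complex.I) := by
  rw [Complex.ofReal_cos, Complex.cos]
  have e1 : Complex.exp ((ω * θ : ℝ) * Complex.I) * Complex.exp (((φ - ω) * s : ℝ) * Complex.I) =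
      Complex.exp (((ω * (θ - s) : ℝ) : ℂ) * Complex.I) * Complex.exp ((φ * s : ℝ) * Complex.I) := by
    rw [← Complex.exp_add, ← Complex.exp_add]; congr 1; push_cast; ring
  have e2 : Complex.exp ((-(ω * θ) : ℝ) * Complex.I) * Complex.exp (((φ + ω) * s : ℝ) * Complex.I) =
      Complex.exp (-(((ω * (θ - s) : ℝ) : ℂ)) * Complex.I) * Complex.exp ((φ * s : ℝ) * Complex.I) := by
    rw [← Complex.exp_add, ← Complex.exp_add]; congr 1; push_cast; ring
  rw [mul_assoc, mul_assoc, e1, e2]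
  push_cast
  ring

/-- Splitting `sin(ω(θ−s)) e^{iφs} = −(i/2) e^{iωθ} e^{i(φ−ω)s} + (i/2) e^{−iωθ} e^{i(φ+ω)s}`. [folklore] -/
theorem sin_mul_exp_split (ω φ θ s : ℝ) :
    (Real.sin (ω * (θ - s)) : ℂ) * Complex.exp ((φ * s : ℝ) * Complex.I) =
      -(Complex.I / 2) * Complex.exp ((ω * θ : ℝ) * Complex.I) * Complex.exp (((φ - ω) * s : ℝ) * Complex.I) +
      (Complex.I / 2) * Complex.exp ((-(ω * θ) : ℝ) * Complex.I) * Complex.exp (((φ + ω) * s : ℝ) * Complex.I) := by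
  rw [Complex.ofReal_sin, Complex.sin]
  have e1 : Complex.exp ((ω * θ : ℝ) * Complex.I) * Complex.exp (((φ - ω) * s : ℝ) * Complex.I) =
      Complex.exp (((ω * (θ - s) : ℝ) : ℂ) * Complex.I) * Complex.exp ((φ * s : ℝ) * Complex.I) := by
    rw [← Complex.exp_add, ← Complex.exp_add]; congr 1; push_cast; ring
  have e2 : Complex.exp ((-(ω * θ) : ℝ) * Complex.I) * Complex.exp (((φ + ω) * s : ℝ) * Complex.I) =
      Complex.exp (-(((ω * (θ - s) : ℝ) : ℂ)) * Complex.I) * Complex.exp ((φ * s : ℝ) * Complex.I) := by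
    rw [← Complex.exp_add, ← Complex.exp_add]; congr 1; push_cast; ring
  rw [mul_assoc, mul_assoc, e1, e2]
  ring

/-- **Stable block × Lorentzian pulse, cosine entry:** for `μ ≠ 0`, `φ − ω ≠ 0`, `φ + ω ≠ 0`, `θ ≥ 0`,
`‖∫₀^θ cos(ω(θ−s)) e^{iφs} C/(μ + i(ν₀+νs)) ds‖ ≤ (‖C‖(2+π)/|μ|) · (1/|φ−ω| + 1/|φ+ω|) / 2`, uniformly in `θ`. [folklore] -/
theorem norm_integral_cos_mul_lorentz_le (C : ℂ) {μ ω φ : ℝ} (hμ : μ ≠ 0) (hm : φ - ω ≠ 0) (hp : φ + ω ≠ 0) (ν₀ ν : ℝ)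
    {θ : ℝ} (hθ : 0 ≤ θ) :
    ‖∫ s in (0 : ℝ)..θ, (Real.cos (ω * (θ - s)) : ℂ) * Complex.exp ((φ * s : ℝ) * Complex.I) *
        (C / ((μ : ℂ) + ((ν₀ + ν * s : ℝ) : ℂ) * Complex.I))‖ ≤
      ‖C‖ * (2 + Real.pi) / |μ| * (1 / |φ - ω| + 1 / |φ + ω|) / 2 := by
  have hsplit : ∀ s : ℝ, (Real.cos (ω * (θ - s)) : ℂ) * Complex.exp ((φ * s : ℝ) * Complex.I) * (C / ((μ : ℂ) + ((ν₀ + ν * s : ℝ) : ℂ) * Complex.I)) =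
      ((1 / 2 : ℝ) : ℂ) * Complex.exp ((ω * θ : ℝ) * Complex.I) * (Complex.exp (((φ - ω) * s : ℝ) * Complex.I) * (C / ((μ : ℂ) + ((ν₀ + ν * s : ℝ) : ℂ) * Complex.I))) +
      ((1 / 2 : ℝ) : ℂ) * Complex.exp ((-(ω * θ) : ℝ) * Complex.I) * (Complex.exp (((φ + ω) * s : ℝ) * Complex.I) * (C / ((μ : ℂ) + ((ν₀ + ν * s : ℝ) : ℂ) * Complex.I))) := by
    intro s; rw [cos_mul_exp_split]; ring
  simp_rw [hsplit]
  have i1 := (continuous_exp_mul_lorentz C hμ (φ - ω) ν₀ ν).intervalIntegrable (μ := volume) 0 θ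
  have i2 := (continuous_exp_mul_lorentz C hμ (φ + ω) ν₀ ν).intervalIntegrable (μ := volume) 0 θ
  rw [intervalIntegral.integral_add (i1.const_mul _) (i2.const_mul _), intervalIntegral.integral_const_mul,
    intervalIntegral.integral_const_mul]
  have b1 := norm_integral_exp_mul_lorentz_le C hμ hm ν₀ ν hθ
  have b2 := norm_integral_exp_mul_lorentz_le C hμ hp ν₀ ν hθ
  have n1 : ‖((1 / 2 : ℝ) : ℂ) * Complex.exp ((ω * θ : ℝ) * Complex.I)‖ = 1 / 2 := by
    rw [norm_mul, Complex.norm_exp_ofReal_mul_I, mul_one, Complex.norm_real, Real.norm_eq_abs, abs_of_pos (by norm_num)]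
  have n2 : ‖((1 / 2 : ℝ) : ℂ) * Complex.exp ((-(ω * θ) : ℝ) * Complex.I)‖ = 1 / 2 := by
    rw [norm_mul, Complex.norm_exp_ofReal_mul_I, mul_one, Complex.norm_real, Real.norm_eq_abs, abs_of_pos (by norm_num)]
  set I1 := ∫ s in (0 : ℝ)..θ, Complex.exp ((((φ - ω) * s : ℝ)) * Complex.I) * (C / ((μ : ℂ) + ((ν₀ + ν * s : ℝ) : ℂ) * Complex.I))
  set I2 := ∫ s in (0 : ℝ)..θ, Complex.exp ((((φ + ω) * s : ℝ)) * Complex.I) * (C / ((μ : ℂ) + ((ν₀ + ν * s : ℝ) : ℂ) * Complex.I))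
  have t1 : ‖((1 / 2 : ℝ) : ℂ) * Complex.exp ((ω * θ : ℝ) * Complex.I) * I1‖ ≤ 1 / 2 * (‖C‖ * (2 + Real.pi) / (|μ| * |φ - ω|)) := by
    rw [norm_mul, n1]; exact mul_le_mul_of_nonneg_left b1 (by norm_num)
  have t2 : ‖((1 / 2 : ℝ) : ℂ) * Complex.exp ((-(ω * θ) : ℝ) * Complex.I) * I2‖ ≤ 1 / 2 * (‖C‖ * (2 + Real.pi) / (|μ| * |φ + ω|)) := by
    rw [norm_mul, n2]; exact mul_le_mul_of_nonneg_left b2 (by norm_num)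
  have hμ0 : 0 < |μ| := abs_pos.2 hμ
  have e : ‖C‖ * (2 + Real.pi) / |μ| * (1 / |φ - ω| + 1 / |φ + ω|) / 2 =
      1 / 2 * (‖C‖ * (2 + Real.pi) / (|μ| * |φ - ω|)) + 1 / 2 * (‖C‖ * (2 + Real.pi) / (|μ| * |φ + ω|)) := by
    field_simp
  rw [e]
  exact (norm_add_le _ _).trans (add_le_add t1 t2)

/-- **Stable block × Lorentzian pulse, sine entry:** for `μ ≠ 0`, `ω ≠ 0`, `φ − ω ≠ 0`, `φ + ω ≠ 0`, `θ ≥ 0`,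
`‖∫₀^θ (sin(ω(θ−s))/ω) e^{iφs} C/(μ + i(ν₀+νs)) ds‖ ≤ (‖C‖(2+π)/|μ|) · (1/|φ−ω| + 1/|φ+ω|) / (2|ω|)`, uniformly in `θ`. [folklore] -/
theorem norm_integral_sin_mul_lorentz_le (C : ℂ) {μ ω φ : ℝ} (hμ : μ ≠ 0) (hω : ω ≠ 0) (hm : φ - ω ≠ 0) (hp : φ + ω ≠ 0) (ν₀ ν : ℝ)
    {θ : ℝ} (hθ : 0 ≤ θ) :
    ‖∫ s in (0 : ℝ)..θ, ((Real.sin (ω * (θ - s)) / ω : ℝ) : ℂ) * Complex.exp ((φ * s : ℝ) * Complex.I) *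
        (C / ((μ : ℂ) + ((ν₀ + ν * s : ℝ) : ℂ) * Complex.I))‖ ≤
      ‖C‖ * (2 + Real.pi) / |μ| * (1 / |φ - ω| + 1 / |φ + ω|) / (2 * |ω|) := by
  have hsplit : ∀ s : ℝ, ((Real.sin (ω * (θ - s)) / ω : ℝ) : ℂ) * Complex.exp ((φ * s : ℝ) * Complex.I) * (C / ((μ : ℂ) + ((ν₀ + ν * s : ℝ) : ℂ) * Complex.I)) =
      (-(Complex.I / 2) / (ω : ℂ)) * Complex.exp ((ω * θ : ℝ) * Complex.I) * (Complex.exp (((φ - ω) * s : ℝ) * Complex.I) * (C / ((μ : ℂ) + ((ν₀ + ν * s : ℝ) : ℂ) * Complex.I))) +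
      ((Complex.I / 2) / (ω : ℂ)) * Complex.exp ((-(ω * θ) : ℝ) * Complex.I) * (Complex.exp (((φ + ω) * s : ℝ) * Complex.I) * (C / ((μ : ℂ) + ((ν₀ + ν * s : ℝ) : ℂ) * Complex.I))) := by
    intro s
    have hωc : (ω : ℂ) ≠ 0 := by exact_mod_cast hω
    have e : ((Real.sin (ω * (θ - s)) / ω : ℝ) : ℂ) * Complex.exp ((φ * s : ℝ) * Complex.I) =
        ((Real.sin (ω * (θ - s)) : ℂ) * Complex.exp ((φ * s : ℝ) * Complex.I)) / (ω : ℂ) := by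
      push_cast; ring
    rw [e, sin_mul_exp_split]
    field_simp
  simp_rw [hsplit]
  have i1 := (continuous_exp_mul_lorentz C hμ (φ - ω) ν₀ ν).intervalIntegrable (μ := volume) 0 θ
  have i2 := (continuous_exp_mul_lorentz C hμ (φ + ω) ν₀ ν).intervalIntegrable (μ := volume) 0 θ
  rw [intervalIntegral.integral_add (i1.const_mul _) (i2.const_mul _), intervalIntegral.integral_const_mul,
    intervalIntegral.integral_const_mul]
  have b1 := norm_integral_exp_mul_lorentz_le C hμ hm ν₀ ν hθ
  have b2 := norm_integral_exp_mul_lorentz_le C hμ hp ν₀ ν hθ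
  have nI : ‖(Complex.I / 2 / (ω : ℂ))‖ = 1 / (2 * |ω|) := by
    rw [norm_div, norm_div, Complex.norm_I, Complex.norm_two, Complex.norm_real, Real.norm_eq_abs, div_div]
  have n1 : ‖(-(Complex.I / 2) / (ω : ℂ)) * Complex.exp ((ω * θ : ℝ) * Complex.I)‖ = 1 / (2 * |ω|) := by
    rw [norm_mul, Complex.norm_exp_ofReal_mul_I, mul_one, neg_div, norm_neg, nI]
  have n2 : ‖(Complex.I / 2 / (ω : ℂ)) * Complex.exp ((-(ω * θ) : ℝ) * Complex.I)‖ = 1 / (2 * |ω|) := by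
    rw [norm_mul, Complex.norm_exp_ofReal_mul_I, mul_one, nI]
  set I1 := ∫ s in (0 : ℝ)..θ, Complex.exp ((((φ - ω) * s : ℝ)) * Complex.I) * (C / ((μ : ℂ) + ((ν₀ + ν * s : ℝ) : ℂ) * Complex.I))
  set I2 := ∫ s in (0 : ℝ)..θ, Complex.exp ((((φ + ω) * s : ℝ)) * Complex.I) * (C / ((μ : ℂ) + ((ν₀ + ν * s : ℝ) : ℂ) * Complex.I))
  have hω0 : 0 < |ω| := abs_pos.2 hω
  have t1 : ‖(-(Complex.I / 2) / (ω : ℂ)) * Complex.exp ((ω * θ : ℝ) * Complex.I) * I1‖ ≤ 1 / (2 * |ω|) * (‖C‖ * (2 + Real.pi) / (|μ| * |φ - ω|)) := by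
    rw [norm_mul, n1]; exact mul_le_mul_of_nonneg_left b1 (by positivity)
  have t2 : ‖(Complex.I / 2 / (ω : ℂ)) * Complex.exp ((-(ω * θ) : ℝ) * Complex.I) * I2‖ ≤ 1 / (2 * |ω|) * (‖C‖ * (2 + Real.pi) / (|μ| * |φ + ω|)) := by
    rw [norm_mul, n2]; exact mul_le_mul_of_nonneg_left b2 (by positivity)
  have hμ0 : 0 < |μ| := abs_pos.2 hμ
  have e : ‖C‖ * (2 + Real.pi) / |μ| * (1 / |φ - ω| + 1 / |φ + ω|) / (2 * |ω|) =
      1 / (2 * |ω|) * (‖C‖ * (2 + Real.pi) / (|μ| * |φ - ω|)) + 1 / (2 * |ω|) * (‖C‖ * (2 + Real.pi) / (|μ| * |φ + ω|)) := by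
    field_simp
  rw [e]
  exact (norm_add_le _ _).trans (add_le_add t1 t2)

end Summit.AnomalousDissipation.AnomalousDissipation.Theorems.SawtoothPulseCascade.K2PhaseBudget

end
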